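import Mathlib
import HarnessLib
import Literature.Probability.MarkovChains.MultiplicativeReversibilization
import Literature.Probability.MarkovChains.VorticityAsymptoticVariance

/-!
# Every chain has no larger asymptotic variance than its additive reversibilization: `v(f, π, P) ≤ v(f, π, ½(P + P̃))` (Bierkens 2016 Prop. 3.1 applied with `P = A(P) + Γ(P,π)/(2π)`; Sun–Gomez–Schmidhuber 2010)

HONEST FRAMING: exact (Metropolis-corrected) sampling algorithms for lattice gauge theory; figures
of merit are autocorrelation/cost numbers at stated couplings and volumes; no continuum-physics claim.

Conventions of `MultiplicativeReversibilization.lean` (`addReversibilization π P = A(P) = ½(P + P̃)`,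
`P̃ = timeReversal π P`) and `VorticityAsymptoticVariance.lean` (`vorticityOf π P = Γ(P, π) =
diag(π)P − Pᵀdiag(π)`, `addVorticity K π Γ = K + Γ/(2π)`, `IsVorticity`, **Bierkens' PROPOSITION
3.1** `Bierkens2015_prop_3_1`: adding a vorticity to a reversible `K` does not increase the asymptotic
variance `asympVar f π ·` of `AsymptoticVarianceSpectral.lean`).  Source READ: J. Bierkens,
*Non-reversible Metropolis–Hastings*, Stat. Comput. 26 (2016) 1213–1228 [Bierkens2015], §2.1
(the decomposition `P = K + Γ/(2π)` with `K = ½(P + P̂)`, Lemma 2.1, Remark 2.2) and §3 Prop. 3.1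
(crediting Sun, Gomez and Schmidhuber 2010 [SunGomezSchmidhuber2010]).  Everything is PROVED
(0 named facts):
* `addVorticity_addReversibilization_vorticityOf` — `A(P) + Γ(P,π)/(2π) = P` [cite: Bierkens2015,
  §2.1 (the displays defining `K = ½(P + P̂)` and `Γ`), Remark 2.2];
* `isIrreducible_addReversibilization` — `P ≤ 2A(P)` entrywise, so `A(P)` is irreducible when `P` is
  [cite: Bierkens2015, §2.1 ("`K` is a reversible Markov chain")];
* **`asympVar_le_addReversibilization`** — for an irreducible stochastic `P` with `πP = π`, `π > 0`:
  `v(f, π, P) ≤ v(f, π, A(P))` for every observable `f` [cite: Bierkens2015, §3 Prop. 3.1 with §2.1;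
  SunGomezSchmidhuber2010].
Context (cell pub-lqcd): the companion of `MultiplicativeReversibilization.lean` (mixing-time side) on
the variance side — a non-reversible sampler is never worse, in asymptotic variance, than the
reversible chain with the same symmetric part.
-/

namespace Literature.Probability.MarkovChains

open Finset Matrix

variable {X : Type*} [Fintype X] [DecidableEq X] {π : X → ℝ} {P : Matrix X X ℝ}

omit [Fintype X] [DecidableEq X] in
/-- `P = A + Γ/(2π)` with `A = ½(P + P̃)` and `Γ = Γ(P, π) = diag(π)P − Pᵀdiag(π)` ("one can think
of `Γ` as (a transformation of) the skew-symmetric part of `P`: `Γ = diag(π)(P − P̂)`", and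
`K = ½(P + P̂)`). [cite: Bierkens2015, §2.1 (the displays defining `K = ½(P + P̂)` and `Γ`),
Remark 2.2] -/
theorem addVorticity_addReversibilization_vorticityOf (hπ : ∀ x, 0 < π x) (P : Matrix X X ℝ) :
    addVorticity (addReversibilization π P) π (vorticityOf π P) = P := by
  ext x y
  rw [addVorticity_apply, addReversibilization_apply, vorticityOf_apply]
  have hx : π x ≠ 0 := (hπ x).ne'
  field_simp
  ring

/-- `P ≤ 2A(P)` entrywise (`P̃ ≥ 0`), so `Pⁿ ≤ 2ⁿ Aⁿ` and `A(P)` is irreducible when `P` is.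
[cite: Bierkens2015, §2.1 (`K = ½(P + P̂)` "is a reversible Markov chain")] -/
theorem isIrreducible_addReversibilization (hπ : ∀ x, 0 < π x) (hP : IsRowStochastic P)
    (hirr : IsIrreducible P) : IsIrreducible (addReversibilization π P) := by
  have hA0 : ∀ x y, 0 ≤ addReversibilization π P x y := addReversibilization_nonneg hπ hP.1
  have hle : ∀ x y, P x y ≤ 2 * addReversibilization π P x y := by
    intro x y
    rw [addReversibilization_apply]
    have : 0 ≤ π y * P y x / π x := div_nonneg (mul_nonneg (hπ y).le (hP.1 y x)) (hπ x).le
    linarith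
  -- entrywise `Pⁿ ≤ 2ⁿ Aⁿ` and `0 ≤ Aⁿ`
  have hpow : ∀ n : ℕ, ∀ x y, 0 ≤ (addReversibilization π P ^ n) x y ∧
      (P ^ n) x y ≤ 2 ^ n * (addReversibilization π P ^ n) x y := by
    intro n
    induction n with
    | zero =>
      intro x y
      simp only [pow_zero, Matrix.one_apply, one_mul]
      by_cases h : x = y <;> simp [h]
    | succ n ih =>
      intro x y
      rw [pow_succ, pow_succ, Matrix.mul_apply, Matrix.mul_apply, pow_succ]
      refine ⟨sum_nonneg fun z _ => mul_nonneg (ih x z).1 (hA0 z y), ?_⟩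
      rw [mul_sum]
      refine sum_le_sum fun z _ => ?_
      calc (P ^ n) x z * P z y ≤ (2 ^ n * (addReversibilization π P ^ n) x z) *
            (2 * addReversibilization π P z y) :=
          mul_le_mul (ih x z).2 (hle z y) (hP.1 z y)
            (mul_nonneg (pow_nonneg zero_le_two n) (ih x z).1)
        _ = 2 ^ n * 2 * ((addReversibilization π P ^ n) x z * addReversibilization π P z y) := by
          ring
  intro x y
  obtain ⟨n, hn⟩ := hirr x y
  refine ⟨n, ?_⟩
  have h2 : (0 : ℝ) < 2 ^ n := pow_pos zero_lt_two n
  exact (mul_pos_iff_of_pos_left h2).1 (hn.trans_le (hpow n x y).2)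

/-- **COROLLARY of Bierkens' Proposition 3.1 (Sun–Gomez–Schmidhuber 2010)**: an irreducible
stochastic `P` with `πP = π` (`π > 0` a probability vector) has, for every observable `f`, asymptotic
variance no larger than its additive reversibilization: `v(f, π, P) ≤ v(f, π, ½(P + P̃))` — apply
Prop. 3.1 to `K = A(P)`, `Γ = Γ(P, π)`, `K + Γ/(2π) = P`. [cite: Bierkens2015, §3 Prop. 3.1 with
§2.1 Lemma 2.1, Remark 2.2; SunGomezSchmidhuber2010] -/
theorem asympVar_le_addReversibilization (hπ : ∀ x, 0 < π x) (hπ1 : ∑ x, π x = 1)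
    (hP : IsRowStochastic P) (hst : IsStationary π P) (hirr : IsIrreducible P) (f : X → ℝ) :
    asympVar f π P ≤ asympVar f π (addReversibilization π P) := by
  have hA : IsRowStochastic (addReversibilization π P) :=
    ⟨addReversibilization_nonneg hπ hP.1, addReversibilization_rowSum hπ hP.2 hst⟩
  have key := Bierkens2015_prop_3_1 hπ hπ1 hA (addReversibilization_detailedBalance hπ)
    (isIrreducible_addReversibilization hπ hP hirr) (isVorticity_vorticityOf hP hst)
    (fun x y => by rw [addVorticity_addReversibilization_vorticityOf hπ]; exact hP.1 x y)
    (by rw [addVorticity_addReversibilization_vorticityOf hπ]; exact hirr) f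
  rwa [addVorticity_addReversibilization_vorticityOf hπ] at key

end Literature.Probability.MarkovChains
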